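import Mathlib.Analysis.SpecialFunctions.Pow.Real
import Mathlib.Data.Nat.Log
import HarnessLib

/-!
# PAPER-2 track, ARM-3 gen 59: the Kozma–Nachmias thin-layer recursion with a general volume-tail exponent

builds on p205010 (kernel theorem, internal audit signed; external expert review pending) — nothing in this
file is an input of p205010, and nothing here uses it.

Kozma–Nachmias (*The Alexander–Orbach conjecture holds in high dimensions*, Invent. Math. 178 (2009), §3.2,
proof of Thm. 1.2 (ii)) bound the chemical (intrinsic) one-arm probability `Γ(r) = sup_G P(∂B(0,r;G) ≠ ∅)` by
`C/r` through the recursion `Γ(3m) ≤ (V/m)·Γ(m)² + P(|C(0)| > V)` (a thin level of the intrinsic ball plus the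
Markov property of the exploration), fed with the MEAN-FIELD volume tail `P(|C(0)| > V) ≤ C₁ V^{-1/2}`.
This file isolates the purely analytic step and runs it with an ARBITRARY volume-tail exponent `a ∈ (0,1)`:

* `Quant.chemicalRecursion_powerLaw` — if `0 ≤ Γ ≤ 1` is antitone and
  `Γ(3m) ≤ (V/m)·Γ(m)² + A·V^{-a}` for all `m ≥ 1`, `V > 0`, then `Γ(r) ≤ C · r^{-a/(1-a)}` for all `r ≥ 1`.

For `a = 1/2` this is KN's exponent `1`; for the (unknown) critical volume exponent `a = 1/δ` of `ℤ^d`,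
`3 ≤ d ≤ 6`, it is the map `1/δ ↦ 1/(δ-1)` from the VOLUME face of the power-law landmark to its ARM face
(used in `…QuantChemicalOneArm`: `{0 ↔ ∂Λ_n} ⊆ {∂B_int(0,n) ≠ ∅}`, so a chemical one-arm bound is an extrinsic
one).  Pure real analysis; no percolation object is mentioned here.
-/

noncomputable section

namespace Summit.CriticalPhenomena.PercolationContinuityZ3.Theorems.Quant

/-- One step of the thin-layer induction, as pure algebra: if `x > 0`, `Γ₁ ≤ K x^{-b}` with `0 ≤ Γ₁`, and
`Γ₃ ≤ (V/x) Γ₁² + A V^{-a}` for every `V > 0`, where `a(1+b) = b`, then for every `ε > 0`,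
`Γ₃ ≤ (ε K² + A ε^{-a}) · x^{-b}` (choose `V = ε x^{1+b}`).
[cite: KozmaNachmias2009, §3.2 proof of Thm. 1.2(ii) (the choice |C| ≤ ε 9^k)] -/
theorem chemicalRecursion_step {Γ₁ Γ₃ K A a b x ε : ℝ} (hx : 0 < x) (hε : 0 < ε) (hK : 0 ≤ K)
    (hab : a * (1 + b) = b) (hΓ₁ : 0 ≤ Γ₁) (hΓ₁K : Γ₁ ≤ K * x ^ (-b))
    (hrec : ∀ V : ℝ, 0 < V → Γ₃ ≤ V / x * Γ₁ ^ 2 + A * V ^ (-a)) :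
    Γ₃ ≤ (ε * K ^ 2 + A * ε ^ (-a)) * x ^ (-b) := by
  have hxb : 0 < x ^ (1 + b) := Real.rpow_pos_of_pos hx _
  have hV : 0 < ε * x ^ (1 + b) := mul_pos hε hxb
  have h := hrec (ε * x ^ (1 + b)) hV
  -- `V / x = ε x^b`
  have hVx : ε * x ^ (1 + b) / x = ε * x ^ b := by
    rw [Real.rpow_add hx, Real.rpow_one]
    field_simp
  -- `Γ₁² ≤ K² x^{-2b}`
  have hsq : Γ₁ ^ 2 ≤ (K * x ^ (-b)) ^ 2 := pow_le_pow_left₀ hΓ₁ hΓ₁K 2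
  have hKxb : 0 ≤ K * x ^ (-b) := mul_nonneg hK (Real.rpow_nonneg hx.le _)
  -- `(ε x^{1+b})^{-a} = ε^{-a} x^{-b}`
  have hVa : (ε * x ^ (1 + b)) ^ (-a) = ε ^ (-a) * x ^ (-b) := by
    rw [Real.mul_rpow hε.le hxb.le, ← Real.rpow_mul hx.le]
    congr 2
    rw [mul_neg, mul_comm (1 + b) a, hab]
  have h1 : ε * x ^ (1 + b) / x * Γ₁ ^ 2 ≤ ε * K ^ 2 * x ^ (-b) := by
    rw [hVx]
    calc ε * x ^ b * Γ₁ ^ 2 ≤ ε * x ^ b * (K * x ^ (-b)) ^ 2 :=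
          mul_le_mul_of_nonneg_left hsq (mul_nonneg hε.le (Real.rpow_nonneg hx.le _))
      _ = ε * K ^ 2 * (x ^ b * (x ^ (-b) * x ^ (-b))) := by ring
      _ = ε * K ^ 2 * x ^ (-b) := by
          rw [← Real.rpow_add hx, ← Real.rpow_add hx]
          congr 2
          ring
  calc Γ₃ ≤ ε * x ^ (1 + b) / x * Γ₁ ^ 2 + A * (ε * x ^ (1 + b)) ^ (-a) := h
    _ ≤ ε * K ^ 2 * x ^ (-b) + A * (ε ^ (-a) * x ^ (-b)) := by rw [hVa]; exact add_le_add h1 le_rfl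
    _ = (ε * K ^ 2 + A * ε ^ (-a)) * x ^ (-b) := by ring

/-- **Kozma–Nachmias' thin-layer recursion with volume-tail exponent `a` gives the power law `r^{-a/(1-a)}`.**
Let `Γ : ℕ → [0,1]` be antitone with `Γ(3m) ≤ (V/m)·Γ(m)² + A·V^{-a}` for all `m ≥ 1` and all real `V > 0`,
where `0 < a < 1` and `0 ≤ A`.  Then there is `C > 0` with `Γ(r) ≤ C · r^{-a/(1-a)}` for every `r ≥ 1`.
(KN09 run the case `a = 1/2`, exponent `1`; the induction is theirs verbatim with `ε 9^k` replaced by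
`ε (3^k)^{1/(1-a)}`: at scale `3^k`, `Γ ≤ K 3^{-bk}` with `b = a/(1-a)`, `ε = K^{-(1+s)}`, `s = (1-a)/(2a)`, and
`K` so large that `K^{-s} ≤ 3^{-b}/2` and `A K^{a(1+s)} ≤ 3^{-b} K/2`.)
[cite: KozmaNachmias2009, §3.2 proof of Thm. 1.2(ii)] -/
theorem chemicalRecursion_powerLaw {Γ : ℕ → ℝ} {A a : ℝ}
    (h0 : ∀ r, 0 ≤ Γ r) (h1 : ∀ r, Γ r ≤ 1) (hanti : Antitone Γ)
    (ha0 : 0 < a) (ha1 : a < 1) (hA : 0 ≤ A)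
    (hrec : ∀ m : ℕ, 1 ≤ m → ∀ V : ℝ, 0 < V →
      Γ (3 * m) ≤ V / m * Γ m ^ 2 + A * V ^ (-a)) :
    ∃ C : ℝ, 0 < C ∧ ∀ r : ℕ, 1 ≤ r → Γ r ≤ C * (r : ℝ) ^ (-(a / (1 - a))) := by
  -- exponents
  set b : ℝ := a / (1 - a) with hb_def
  have h1a : 0 < 1 - a := by linarith
  have hb : 0 < b := div_pos ha0 h1a
  have hab : a * (1 + b) = b := by
    rw [hb_def]; field_simp; ring
  set s : ℝ := (1 - a) / (2 * a) with hs_def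
  have hs : 0 < s := div_pos h1a (by linarith)
  have has : 1 - a * (1 + s) = (1 - a) / 2 := by
    rw [hs_def]; field_simp; ring
  have he : 0 < (1 - a) / 2 := by linarith
  -- the constant `K`
  set T : ℝ := (3 : ℝ) ^ b with hT_def
  have hT : 0 < T := Real.rpow_pos_of_pos (by norm_num) _
  have hT1 : 1 ≤ T := Real.one_le_rpow (by norm_num) hb.le
  set K₂ : ℝ := (2 * T) ^ s⁻¹ with hK₂_def
  set K₃ : ℝ := (2 * A * T) ^ ((1 - a) / 2)⁻¹ with hK₃_def
  set K : ℝ := max 1 (max K₂ K₃) with hK_def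
  have hK1 : 1 ≤ K := le_max_left _ _
  have hK0 : 0 < K := lt_of_lt_of_le one_pos hK1
  have hKK₂ : K₂ ≤ K := (le_max_left _ _).trans (le_max_right _ _)
  have hKK₃ : K₃ ≤ K := (le_max_right _ _).trans (le_max_right _ _)
  -- (ii) `K^{-s} ≤ 1/(2T)`
  have hKs : K ^ (-s) ≤ 1 / (2 * T) := by
    have h2T : 0 < 2 * T := by positivity
    have hK₂s : K₂ ^ s = 2 * T := by
      rw [hK₂_def, Real.rpow_inv_rpow h2T.le hs.ne']
    have : 2 * T ≤ K ^ s := by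
      rw [← hK₂s]
      exact Real.rpow_le_rpow (Real.rpow_nonneg h2T.le _) hKK₂ hs.le
    rw [Real.rpow_neg hK0.le, one_div]
    exact inv_anti₀ h2T this
  -- (iii) `A K^{a(1+s)} ≤ K/(2T)`
  have hKA : A * K ^ (a * (1 + s)) ≤ K / (2 * T) := by
    have h2AT : 0 ≤ 2 * A * T := by positivity
    have hK₃e : K₃ ^ ((1 - a) / 2) = 2 * A * T := by
      rw [hK₃_def, Real.rpow_inv_rpow h2AT he.ne']
    have hle : 2 * A * T ≤ K ^ ((1 - a) / 2) := by
      rw [← hK₃e]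
      exact Real.rpow_le_rpow (Real.rpow_nonneg h2AT _) hKK₃ he.le
    -- `K = K^{a(1+s)} · K^{(1-a)/2}`
    have hsplit : K = K ^ (a * (1 + s)) * K ^ ((1 - a) / 2) := by
      rw [← Real.rpow_add hK0, ← has]
      ring_nf
      exact (Real.rpow_one K).symm
    have hKas : 0 < K ^ (a * (1 + s)) := Real.rpow_pos_of_pos hK0 _
    rw [le_div_iff₀ (by positivity : (0 : ℝ) < 2 * T)]
    calc A * K ^ (a * (1 + s)) * (2 * T) = K ^ (a * (1 + s)) * (2 * A * T) := by ring
      _ ≤ K ^ (a * (1 + s)) * K ^ ((1 - a) / 2) := mul_le_mul_of_nonneg_left hle hKas.le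
      _ = K := hsplit.symm
  -- the choice `ε = K^{-(1+s)}` and the bound `ε K² + A ε^{-a} ≤ K/T`
  set ε : ℝ := K ^ (-(1 + s)) with hε_def
  have hε : 0 < ε := Real.rpow_pos_of_pos hK0 _
  have hεK : ε * K ^ 2 + A * ε ^ (-a) ≤ K / T := by
    have e1 : ε * K ^ 2 = K * K ^ (-s) := by
      rw [hε_def, ← Real.rpow_two, ← Real.rpow_add hK0,
        show K * K ^ (-s) = K ^ (1 : ℝ) * K ^ (-s) by rw [Real.rpow_one], ← Real.rpow_add hK0]
      congr 1; ring
    have e2 : ε ^ (-a) = K ^ (a * (1 + s)) := by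
      rw [hε_def, ← Real.rpow_mul hK0.le]
      congr 1; ring
    rw [e1, e2]
    have hh1 : K * K ^ (-s) ≤ K / (2 * T) := by
      calc K * K ^ (-s) ≤ K * (1 / (2 * T)) := mul_le_mul_of_nonneg_left hKs hK0.le
        _ = K / (2 * T) := by ring
    calc K * K ^ (-s) + A * K ^ (a * (1 + s)) ≤ K / (2 * T) + K / (2 * T) := add_le_add hh1 hKA
      _ = K / T := by ring
  -- induction over the scales `3^k`
  have main : ∀ k : ℕ, Γ (3 ^ k) ≤ K * ((3 : ℝ) ^ k) ^ (-b) := by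
    intro k
    induction k with
    | zero =>
        simp only [pow_zero, Real.one_rpow, mul_one]
        exact (h1 1).trans hK1
    | succ k ih =>
        have hx : (0 : ℝ) < (3 : ℝ) ^ k := by positivity
        have hrec' : ∀ V : ℝ, 0 < V →
            Γ (3 ^ (k + 1)) ≤ V / (3 : ℝ) ^ k * Γ (3 ^ k) ^ 2 + A * V ^ (-a) := by
          intro V hV
          have := hrec (3 ^ k) (Nat.one_le_pow _ _ (by norm_num)) V hV
          rw [pow_succ, mul_comm]
          push_cast at this
          exact this
        have step := chemicalRecursion_step (Γ₁ := Γ (3 ^ k)) (Γ₃ := Γ (3 ^ (k + 1))) hx hε hK0.le hab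
          (h0 _) ih hrec'
        calc Γ (3 ^ (k + 1)) ≤ (ε * K ^ 2 + A * ε ^ (-a)) * ((3 : ℝ) ^ k) ^ (-b) := step
          _ ≤ K / T * ((3 : ℝ) ^ k) ^ (-b) :=
              mul_le_mul_of_nonneg_right hεK (Real.rpow_nonneg hx.le _)
          _ = K * ((3 : ℝ) ^ (k + 1)) ^ (-b) := by
              rw [hT_def, pow_succ, Real.mul_rpow hx.le (by norm_num : (0 : ℝ) ≤ 3),
                Real.rpow_neg (by norm_num : (0 : ℝ) ≤ 3) b]
              ring
  -- interpolation between scales, `C = K · 3^b`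
  refine ⟨K * T, mul_pos hK0 hT, fun r hr => ?_⟩
  have hr0 : r ≠ 0 := by omega
  set k := Nat.log 3 r with hk
  have hkr : 3 ^ k ≤ r := Nat.pow_log_le_self 3 hr0
  have hrk : r < 3 ^ (k + 1) := Nat.lt_pow_succ_log_self (by norm_num) r
  have hx : (0 : ℝ) < (3 : ℝ) ^ k := by positivity
  have hrpos : (0 : ℝ) < r := by exact_mod_cast (show 0 < r by omega)
  -- `(3^k)^{-b} ≤ (r/3)^{-b} = 3^b r^{-b}`
  have hr3 : (r : ℝ) / 3 ≤ (3 : ℝ) ^ k := by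
    rw [div_le_iff₀ (by norm_num : (0 : ℝ) < 3)]
    have : (r : ℝ) < (3 : ℝ) ^ (k + 1) := by exact_mod_cast hrk
    rw [pow_succ] at this
    exact this.le
  have hmono : ((3 : ℝ) ^ k) ^ (-b) ≤ ((r : ℝ) / 3) ^ (-b) :=
    Real.rpow_le_rpow_of_nonpos (by positivity) hr3 (by linarith)
  have hsplit : ((r : ℝ) / 3) ^ (-b) = T * (r : ℝ) ^ (-b) := by
    rw [div_eq_mul_inv, Real.mul_rpow hrpos.le (by norm_num), Real.inv_rpow (by norm_num : (0:ℝ) ≤ 3),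
      Real.rpow_neg (by norm_num : (0 : ℝ) ≤ 3), inv_inv, hT_def]
    ring
  calc Γ r ≤ Γ (3 ^ k) := hanti hkr
    _ ≤ K * ((3 : ℝ) ^ k) ^ (-b) := main k
    _ ≤ K * ((r : ℝ) / 3) ^ (-b) := mul_le_mul_of_nonneg_left hmono hK0.le
    _ = K * T * (r : ℝ) ^ (-b) := by rw [hsplit]; ring

end Summit.CriticalPhenomena.PercolationContinuityZ3.Theorems.Quant

end
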